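import Summits.SmoothPoincare4.SmoothPoincare4.Theorems.RootDecompAEDoublesBeyondShadowTwoLedgerWords

/-!
# Grade-four ownership ledger `LocalTableLE4 → GradeFourDichotomy` for KMN encoding graphs, part 5/15: soundness of `roeSearch`

§5 `splitAt_spec` (a word with one occurrence of `x` is conjugate to `(x·W)^{±1}`, `W` free of `x`) and `roe_sound`: a
successful `roeSearch` from a state satisfying the invariants of a partial local elimination (words conjugate to the
substituted port words, remaining letters fresh and fixed, the substitution valued in the remaining letters) extends
to a passing local check `lcheck` using every listed port once (induction on fuel).

THE FAMILY (14 modules `Theorems/RootDecompAEDoublesBeyondShadowTwoLedger*.lean` + the closing module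
`Theorems/RootDecompAEDoublesBeyondShadowTwoStubLedgerFour.lean`, one namespace
`Summit.SmoothPoincare4.SmoothPoincare4.Theorems.RootDecompAEDoublesBeyondShadowTwoStubLedgerFour`, linearly chained
imports, split by topic to respect the 400-line bound on proof files).
-/

open Function
open Literature.Topology.FourManifolds

set_option linter.dupNamespace false

noncomputable section

namespace Summit.SmoothPoincare4.SmoothPoincare4.Theorems.RootDecompAEDoublesBeyondShadowTwoStubLedgerFour

/-! ## §5 Soundness of the block calculus' `roeSearch`: a successful search yields a local certificate -/

namespace Block

/-- Occurrence counts are invariant under `winv`. -/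
theorem occurrences_winv (w : List (ℕ × Bool)) (x : ℕ) : occurrences (winv w) x = occurrences w x := by
  unfold occurrences winv
  rw [List.countP_reverse, List.countP_map]
  rfl

/-- `splitAt` on a word containing the index `x` exactly once: the word is conjugate to `(x · W)^{±1}`, `W` has only
letter indices of the word, and none equal to `x`. -/
theorem splitAt_spec (w : List (ℕ × Bool)) (x : ℕ) (hocc : occurrences w x = 1) :
    IsConj (toFG5 w) (if (splitAt w x).1 then FreeGroup.of (f5 x) * toFG5 (splitAt w x).2
        else (FreeGroup.of (f5 x) * toFG5 (splitAt w x).2)⁻¹) ∧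
      (∀ g ∈ (splitAt w x).2, ∃ g' ∈ w, g'.1 = g.1) ∧ occurrences (splitAt w x).2 x = 0 := by
  set k := w.findIdx (fun g => g.1 = x) with hkdef
  have hex : ∃ g ∈ w, (fun g : ℕ × Bool => decide (g.1 = x)) g = true := by
    by_contra hne
    push Not at hne
    have h0 : occurrences w x = 0 := by
      unfold occurrences
      exact List.countP_eq_zero.mpr fun g hg => by simpa using hne g hg
    omega
  have hk : k < w.length := List.findIdx_lt_length_of_exists hex
  have hpk : (w[k]).1 = x := by
    have := List.findIdx_getElem (p := fun g : ℕ × Bool => decide (g.1 = x)) (w := hk)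
    simpa using this
  set h := w[k] with hh
  set U := w.drop (k + 1) ++ w.take k with hU
  have hrot : w.rotate k = h :: U := by
    rw [List.rotate_eq_drop_append_take hk.le, List.drop_eq_getElem_cons hk]; rfl
  have hsplit : splitAt w x = (h.2, if h.2 then U else winv U) := by
    unfold splitAt
    simp only [← hkdef, hrot]
  have hperm : (h :: U).Perm w := hrot ▸ List.rotate_perm w k
  have hconj : IsConj (toFG5 w) (toFG5 (h :: U)) := by
    have := isConj_toFG5_append_comm (w.take k) (w.drop k)
    rw [List.take_append_drop] at this
    rwa [← hrot, List.rotate_eq_drop_append_take hk.le]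
  have hmemU : ∀ g ∈ U, g ∈ w := fun g hg => by
    rcases List.mem_append.mp hg with hg | hg
    · exact List.mem_of_mem_drop hg
    · exact List.mem_of_mem_take hg
  have hoccU : occurrences U x = 0 := by
    have h1 : occurrences (h :: U) x = 1 := by
      unfold occurrences at hocc ⊢
      rw [List.Perm.countP_eq _ hperm]; exact hocc
    unfold occurrences at h1 ⊢
    rw [List.countP_cons_of_pos (by simpa using hpk)] at h1
    omega
  rw [hsplit]
  have hconj' : IsConj (toFG5 w) (toFG5 [h] * toFG5 U) := by rw [← toFG5_cons]; exact hconj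
  rw [toFG5_single, hpk] at hconj'
  rcases Bool.eq_false_or_eq_true h.2 with hb | hb <;> rw [hb] at hconj' ⊢
  · simp only [if_true] at hconj' ⊢
    exact ⟨hconj', fun g hg => ⟨g, hmemU g hg, rfl⟩, hoccU⟩
  · simp only [Bool.false_eq_true, if_false, toFG5_winv, mul_inv_rev, inv_inv, occurrences_winv] at hconj' ⊢
    refine ⟨hconj'.trans (isConj_iff.mpr ⟨FreeGroup.of (f5 x), by group⟩), fun g hg => ?_, hoccU⟩
    obtain ⟨g', hg', he⟩ := mem_winv hg
    exact ⟨g', hmemU g' hg', he⟩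

/-- A word on letters from `S` lies in the subgroup generated by the letters of `S`. -/
theorem toFG5_mem_closure (W : List (ℕ × Bool)) (S : Set ℕ) (h : ∀ g ∈ W, g.1 ∈ S) :
    toFG5 W ∈ Subgroup.closure ((fun x : ℕ => FreeGroup.of (f5 x)) '' S) := by
  induction W with
  | nil => rw [toFG5_nil]; exact Subgroup.one_mem _
  | cons g W ih =>
    rw [toFG5_cons]
    refine Subgroup.mul_mem _ ?_ (ih fun g' hg' => h g' (by simp [hg']))
    have hg : FreeGroup.of (f5 g.1) ∈ Subgroup.closure ((fun x : ℕ => FreeGroup.of (f5 x)) '' S) :=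
      Subgroup.subset_closure ⟨g.1, h g (by simp), rfl⟩
    rw [toFG5_single]
    split_ifs
    · exact hg
    · exact Subgroup.inv_mem _ hg

end Block

section RoeSound

open Block

/-- Killing letters outside a word fixes the word. -/
theorem lkill_toFG5 (L : List (Fin 5)) (W : List (ℕ × Bool)) (h : ∀ g ∈ W, f5 g.1 ∉ L) :
    lkill L (toFG5 W) = toFG5 W := by
  induction W with
  | nil => simp
  | cons g W ih =>
    rw [toFG5_cons, map_mul, ih (fun g' hg' => h g' (by simp [hg'])), toFG5_single]
    have hg := h g (by simp)
    cases g.2 <;> simp [lkill, hg]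

/-- Substitutions commute with evaluation: `lift (φ ∘ Λ) = φ ∘ lift Λ`. -/
theorem lift_comp_eq {β : Type} [Group β] {γ : Type} [Group γ] (φ : β →* γ) (Λ : Fin 5 → β) :
    FreeGroup.lift (fun y => φ (Λ y)) = φ.comp (FreeGroup.lift Λ) := by
  refine FreeGroup.ext_hom _ _ fun y => ?_
  simp

/-- Unfolding the local check on a cons. -/
theorem lcheck_cons_iff (p : Piece) (s : LStep) (rest : List LStep) (Λ : Fin 5 → FreeGroup (Fin 5)) (El : List (Fin 5)) :
    lcheck p (s :: rest) Λ El = true ↔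
      s.letter ∉ El ∧ lkill (s.letter :: El) s.word = s.word ∧
        s.conj * sgnw s.sgn (FreeGroup.lift Λ (p.portWord s.port)) * s.conj⁻¹ = FreeGroup.of s.letter * s.word ∧
          lcheck p rest (fun y => Roe.substHom s.letter s.word (Λ y)) (s.letter :: El) = true := by
  rw [lcheck]
  simp only [Bool.and_eq_true, Bool.not_eq_true', decide_eq_false_iff_not, decide_eq_true_eq, and_assoc]

/-- Unfolding the local check on the empty step list. -/
theorem lcheck_nil_iff (p : Piece) (Λ : Fin 5 → FreeGroup (Fin 5)) (El : List (Fin 5)) :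
    lcheck p [] Λ El = true ↔ ∀ i : Fin 5, i ∈ El ∧ Λ i = 1 := by
  rw [lcheck, List.all_eq_true]
  simp only [List.mem_finRange, true_implies, Bool.and_eq_true, decide_eq_true_eq]

/-- **SOUNDNESS OF `roeSearch`.**  A successful search from a state whose words represent (up to conjugacy) the substituted
port words of the listed ports, with the bookkeeping invariants of a partial local elimination, extends to a passing local
check using every listed port exactly once. -/
theorem roe_sound (p : Piece) : ∀ (fuel : ℕ) (rels : List (List (ℕ × Bool))) (letters : List ℕ) (js : List ℕ)
    (Λ : Fin 5 → FreeGroup (Fin 5)) (El : List (Fin 5)),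
    roeSearch fuel rels letters = true →
    rels.length = js.length →
    (∀ (i : ℕ) (q : List (ℕ × Bool)) (j : ℕ), rels[i]? = some q → js[i]? = some j →
      IsConj (toFG5 q) (FreeGroup.lift Λ (p.portWord j))) →
    (∀ q ∈ rels, ∀ g ∈ q, g.1 ∈ letters) →
    (∀ x ∈ letters, x < 5) → letters.Nodup →
    (∀ x ∈ letters, f5 x ∉ El ∧ Λ (f5 x) = FreeGroup.of (f5 x)) →
    (∀ y : Fin 5, (y : ℕ) ∉ letters → y ∈ El) →
    (∀ y : Fin 5, Λ y ∈ Subgroup.closure ((fun x : ℕ => FreeGroup.of (f5 x)) '' {x | x ∈ letters})) →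
    ∃ steps : List LStep, lcheck p steps Λ El = true ∧ (steps.map LStep.port).Perm js
  | 0, rels, letters, js, Λ, El, hroe, _, _, _, _, _, _, _, _ => by
    rw [roeSearch] at hroe; exact absurd hroe Bool.false_ne_true
  | fuel + 1, rels, letters, js, Λ, El, hroe, hlen, hconj, hlet, hlt5, hnd, hfresh, hel, hclo => by
    rw [roeSearch] at hroe
    by_cases hemp : (rels.isEmpty && letters.isEmpty) = true
    · rw [Bool.and_eq_true, List.isEmpty_iff, List.isEmpty_iff] at hemp
      obtain ⟨rfl, rfl⟩ := hemp
      have hjs : js = [] := List.eq_nil_of_length_eq_zero (by simpa using hlen.symm)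
      subst hjs
      refine ⟨[], ?_, List.Perm.refl _⟩
      rw [lcheck_nil_iff]
      intro i
      refine ⟨hel i (by simp), ?_⟩
      have := hclo i
      simpa using this
    · rw [if_neg hemp] at hroe
      by_cases hemp2 : (rels.isEmpty || letters.isEmpty) = true
      · rw [if_pos hemp2] at hroe; exact absurd hroe Bool.false_ne_true
      rw [if_neg hemp2, List.any_eq_true] at hroe
      obtain ⟨ri, hri, hroe⟩ := hroe
      rw [List.any_eq_true] at hroe
      obtain ⟨x, hx, hroe⟩ := hroe
      rw [Bool.and_eq_true, beq_iff_eq] at hroe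
      obtain ⟨hocc, hrec⟩ := hroe
      rw [List.mem_range] at hri
      have hw : rels.getD ri [] = rels[ri] := by
        rw [List.getD_eq_getElem?_getD, List.getElem?_eq_getElem hri]; rfl
      rw [hw] at hocc hrec
      set w := rels[ri] with hwdef
      have hx5 : x < 5 := hlt5 x hx
      have hsmall : Small w := fun g hg => hlt5 _ (hlet w (List.getElem_mem hri) g hg)
      obtain ⟨hsc, hWmem, hWocc⟩ := splitAt_spec w x hocc
      set ε := (splitAt w x).1 with hε
      set Wl := (splitAt w x).2 with hWl
      have hrj : ri < js.length := hlen ▸ hri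
      set j := js[ri] with hjdef
      -- the port word at `j` under `Λ`, and its conjugacy to `(x · W)^{±1}`
      have hcj : IsConj (toFG5 w) (FreeGroup.lift Λ (p.portWord j)) :=
        hconj ri w j (by rw [hwdef]; exact List.getElem?_eq_getElem hri) (by rw [hjdef]; exact List.getElem?_eq_getElem hrj)
      have hconj' : IsConj (sgnw (!ε) (FreeGroup.lift Λ (p.portWord j))) (FreeGroup.of (f5 x) * toFG5 Wl) := by
        have h1 := hcj.symm.trans hsc
        rcases Bool.eq_false_or_eq_true ε with hb | hb <;> rw [hb] at h1 ⊢
        · simp only [if_true] at h1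
          simpa [sgnw] using h1
        · simp only [Bool.false_eq_true, if_false] at h1
          simp only [Bool.not_false, sgnw, if_true]
          obtain ⟨d, hd⟩ := isConj_iff.mp h1
          refine isConj_iff.mpr ⟨d, ?_⟩
          have := congrArg (·⁻¹) hd
          simp only [mul_inv_rev, inv_inv] at this
          rw [← this]; group
      obtain ⟨c, hc⟩ := isConj_iff.mp hconj'
      -- the new state
      set W5 := toFG5 Wl with hW5
      set Λ' : Fin 5 → FreeGroup (Fin 5) := fun y => Roe.substHom (f5 x) W5 (Λ y) with hΛ'
      have hWlet : ∀ g ∈ Wl, g.1 ∈ letters ∧ g.1 ≠ x := by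
        intro g hg
        obtain ⟨g', hg', he⟩ := hWmem g hg
        refine ⟨he ▸ hlet w (List.getElem_mem hri) g' hg', fun hgx => ?_⟩
        have : 0 < occurrences Wl x := by
          unfold occurrences; exact List.countP_pos_iff.mpr ⟨g, hg, by simpa using hgx⟩
        omega
      -- recursive call
      obtain ⟨steps, hsteps, hperm⟩ := roe_sound p fuel
        ((rels.eraseIdx ri).map fun q => substitute q x (winv Wl)) (letters.erase x) (js.eraseIdx ri) Λ' (f5 x :: El)
        hrec
        (by rw [List.length_map, List.length_eraseIdx_of_lt hri, List.length_eraseIdx_of_lt hrj, hlen])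
        (by
          intro i q j' hq hj'
          rw [List.getElem?_map] at hq
          obtain ⟨q₀, hq₀, rfl⟩ := Option.map_eq_some_iff.mp hq
          rw [List.getElem?_eraseIdx] at hq₀ hj'
          have hi : IsConj (toFG5 q₀) (FreeGroup.lift Λ (p.portWord j')) := by
            split_ifs at hq₀ hj' with hlt
            · exact hconj i q₀ j' hq₀ hj'
            · exact hconj (i + 1) q₀ j' hq₀ hj'
          have hq₀mem : q₀ ∈ rels := by
            split_ifs at hq₀ with hlt
            · exact List.mem_of_getElem? hq₀
            · exact List.mem_of_getElem? hq₀
          have hsm : Small q₀ := fun g hg => hlt5 _ (hlet q₀ hq₀mem g hg)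
          refine (isConj_toFG5_substitute q₀ Wl x hsm hx5).trans ?_
          have := MonoidHom.map_isConj (Roe.substHom (f5 x) W5) hi
          rwa [← MonoidHom.comp_apply, ← lift_comp_eq] at this)
        (by
          intro q hq g hg
          rw [List.mem_map] at hq
          obtain ⟨q₀, hq₀, rfl⟩ := hq
          have hq₀mem : q₀ ∈ rels := List.mem_of_mem_eraseIdx hq₀
          rcases mem_substitute hg with ⟨g', hg', he, hne⟩ | ⟨g', hg', he⟩
          · rw [← he]; exact (hnd.mem_erase_iff).mpr ⟨hne, hlet q₀ hq₀mem g' hg'⟩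
          · obtain ⟨g'', hg'', he'⟩ := mem_winv hg'
            obtain ⟨hm, hn⟩ := hWlet g'' hg''
            rw [← he, ← he']; exact (hnd.mem_erase_iff).mpr ⟨hn, hm⟩)
        (fun y hy => hlt5 y (List.mem_of_mem_erase hy))
        (hnd.erase x)
        (by
          intro y hy
          obtain ⟨hyx, hyl⟩ := (hnd.mem_erase_iff).mp hy
          obtain ⟨hyEl, hΛy⟩ := hfresh y hyl
          have hne5 : f5 y ≠ f5 x := fun h => hyx (f5_inj (hlt5 y hyl) hx5 h)
          refine ⟨?_, ?_⟩
          · simp only [List.mem_cons, not_or]; exact ⟨hne5, hyEl⟩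
          · simp only [hΛ', hΛy, Roe.substHom, FreeGroup.lift_apply_of, if_neg hne5])
        (by
          intro y hy
          by_cases hyx : y = f5 x
          · exact hyx ▸ List.mem_cons_self
          · refine List.mem_cons_of_mem _ (hel y fun hyl => hy ?_)
            refine (hnd.mem_erase_iff).mpr ⟨fun h => hyx ?_, hyl⟩
            ext; rw [f5_val hx5]; exact h)
        (by
          intro y
          simp only [hΛ']
          have hsub : Subgroup.closure ((fun x : ℕ => FreeGroup.of (f5 x)) '' {x | x ∈ letters}) ≤
              (Subgroup.closure ((fun x' : ℕ => FreeGroup.of (f5 x')) '' {x' | x' ∈ letters.erase x})).comap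
                (Roe.substHom (f5 x) W5) := by
            rw [Subgroup.closure_le]
            rintro _ ⟨z, hz, rfl⟩
            rw [SetLike.mem_coe, Subgroup.mem_comap]
            by_cases hzx : z = x
            · subst hzx
              simp only [Roe.substHom, FreeGroup.lift_apply_of, if_true]
              refine Subgroup.inv_mem _ (toFG5_mem_closure Wl _ fun g hg => ?_)
              obtain ⟨hm, hn⟩ := hWlet g hg
              exact (hnd.mem_erase_iff).mpr ⟨hn, hm⟩
            · have hne5 : f5 z ≠ f5 x := fun h => hzx (f5_inj (hlt5 z hz) hx5 h)
              simp only [Roe.substHom, FreeGroup.lift_apply_of, if_neg hne5]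
              exact Subgroup.subset_closure ⟨z, (hnd.mem_erase_iff).mpr ⟨hzx, hz⟩, rfl⟩
          exact hsub (hclo y))
      -- assemble the step
      refine ⟨⟨j, f5 x, W5, !ε, c⟩ :: steps, ?_, ?_⟩
      · rw [lcheck_cons_iff]
        refine ⟨(hfresh x hx).1, ?_, hc, hsteps⟩
        refine lkill_toFG5 _ Wl fun g hg => ?_
        obtain ⟨hm, hn⟩ := hWlet g hg
        have hne5 : f5 g.1 ≠ f5 x := fun h => hn (f5_inj (hlt5 _ hm) hx5 h)
        simp only [List.mem_cons, not_or]
        exact ⟨hne5, (hfresh g.1 hm).1⟩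
      · rw [List.map_cons]
        have := (List.perm_insertIdx j (js.eraseIdx ri) (i := ri)
          (by rw [List.length_eraseIdx_of_lt hrj]; omega)).symm
        rw [List.insertIdx_eraseIdx_getElem hrj] at this
        exact (List.Perm.cons j hperm).trans this

end RoeSound

end Summit.SmoothPoincare4.SmoothPoincare4.Theorems.RootDecompAEDoublesBeyondShadowTwoStubLedgerFour
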